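/-
Copyright (c) 2026. All rights reserved.
Released under Apache 2.0 license as described in the file LICENSE.
-/
import Literature.NumberTheory.ComplexMultiplication.DegenerateCMTypesAbelianKernels
import HarnessLib

/-!
# Kubota's defect by kernels III: kernels of INDEX `4` — the characters of a cyclic quartic quotient vanish on a CM
# type iff the type meets EVERY coset of the kernel in exactly half; `rank + #B₂ + 2·#B₄ ≤ |G|/2 + 1`, with equality
# on groups of exponent `4`

T. Kubota, *On the field extension by complex multiplication*, Trans. AMS 118 (1965) [Kubota1965], §4 LEMMA 2: the
defect of a CM type of a finite abelian group `G` (complex conjugation `ρ`) is the number of odd characters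
vanishing on it.  The tree's `DegenerateCMTypesAbelianKernels` groups these characters by KERNEL
(`typeRank_add_sum_totient_eq`: `rank(S) + Σ_H φ([G:H]) = |G|/2 + 1` over the subgroups `H ∌ ρ` with `G/H` cyclic
whose characters vanish on `S`; all or none per kernel, `forall_sum_char_eq_zero_iff_exists`) and decides the
vanishing at the kernels of index `2p^{a+1}` (`p` odd: equidistribution) and of index `2` (even split,
`sum_char_eq_zero_iff_of_index_two`).  THIS FILE decides the kernels of INDEX `4` (the «cyclic quartic» kernels; on
a CM field: the CM subfields `F = K^H` with `Gal(F/ℚ) ≅ ℤ/4`):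

* §1 **`sum_char_eq_zero_iff_of_index_four`** — for a CM type `S` (`S ⊔ ρS = G`), a subgroup `H ∌ ρ` of index `4`
  and a character `χ` with `ker χ = H` (so `G/H ≅ ℤ/4`, `χ` takes the values `1, i, −1, −i` on the four cosets and
  `χ(ρ) = −1`): `Σ_{s∈S} χ(s) = 0 ⟺ 2·#(S ∩ gH) = |H|` for EVERY `g ∈ G` — the type meets every coset of `H` in
  exactly half.  PROOF: `Σ_S χ = (c₁ − c₋₁) + (c_i − c₋ᵢ)·i` with `c_v = #{s ∈ S : χ(s) = v}`; as `χ(ρs) = −χ(s)` and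
  `S ⊔ ρS = G`, `c_v + c_{−v} = #{g : χ(g) = v} = |H|`; so vanishing iff `2c₁ = 2c_i = |H|` iff all four
  `2c_v = |H|`.  (B. B. Gordon [Gordon1999HodgeAVSurvey] 9.4.3, Yanai's criterion `a = b` over the cyclic CM
  subquotient; the tree's `AbelianTwoPower.equidistributed_of_sum_eq_zero` is the character form for characters of
  `2`-power order — here the COSET form at index `4`, for any finite abelian `G`.)
  `forall_sum_char_eq_zero_iff_of_index_four` (all characters of kernel `H` at once).
* §2 **`typeRank_add_card_add_two_mul_card_le`** — for every CM type of every finite abelian group: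
  `rank(S) + #B₂ + 2·#B₄ ≤ |G|/2 + 1`, `B₂` = the index-`2` subgroups `H ∌ ρ` splitting `S` evenly (`φ(2) = 1`
  character each), `B₄` = the index-`4` subgroups `H ∌ ρ` with cyclic quotient meeting `S` in half of every coset
  (`φ(4) = 2` characters each); **`typeRank_add_card_add_two_mul_card_eq`** — EQUALITY on groups of EXPONENT `4`
  (`g⁴ = 1`: every admissible kernel has index `2` or `4`, `index_eq_two_or_four_of_isCyclic_quotient`); and the
  nondegeneracy criterion `typeRank_eq_iff_of_exponent_four`.

HONEST SCOPE.  A regrouping of Kubota's count (kernels of index `4`), not a printed formula; the odd-prime-power and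
index-`2` kernels are the neighbouring file's, not restated.  THEOREMS ONLY: no definition, no named fact, no
instance, no `sorry`.

## References

* [Kubota1965] T. Kubota, Trans. AMS 118 (1965), §4 Lemma 2 (held text, p. 119).
* [Gordon1999HodgeAVSurvey] B. B. Gordon, *A survey of the Hodge conjecture for abelian varieties*, 9.4.1, 9.4.3
  (Theorem [B.140] = Yanai 1994: the `a = b` criterion over a cyclic CM subquotient).
* [White1993SporadicCycles] S. P. White, Compositio Math. 88 (1993), §4, proof of Lemma 3 (p. 131) (kernels).
* [Dodson1984] B. Dodson, Trans. AMS 283 (1984), §3.1.1 (the imaginary quadratic case).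

## Provenance

Lane `lit-hodgefound` (Track 2, Layer A3), seat `lit-hodgefound-p10` generation 37, row g37-#5; neighbours cited by
name, nothing restated: `DegenerateCMTypesAbelianKernels` (`typeRank_add_sum_totient_eq`, `isCyclic_quotient_of_ker`,
`exists_oddChar_ker`, `forall_sum_char_eq_zero_iff_exists`, `sum_char_eq_zero_iff_of_index_two`,
`forall_sum_char_eq_zero_iff_of_index_two`).
-/

open scoped BigOperators Classical

namespace Literature.NumberTheory.ComplexMultiplication

namespace CyclicCMType

namespace AbelianKernels

variable {G : Type*} [CommGroup G] [Fintype G] [DecidableEq G] {ρ : G} {Φ : Finset G}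

/-! ## §0 Helpers -/

section Helpers

omit [Fintype G] [DecidableEq G] in
/-- `χ(gh) = χ(g)χ(h)`. [folklore] -/
private theorem char_mul₄ (χ : AddChar (Additive G) ℂ) (g h : G) :
    χ (Additive.ofMul (g * h)) = χ (Additive.ofMul g) * χ (Additive.ofMul h) := by
  rw [ofMul_mul, AddChar.map_add_eq_mul]

omit [Fintype G] [DecidableEq G] in
/-- `χ(g^e) = χ(g)^e`. [folklore] -/
private theorem char_pow₄ (χ : AddChar (Additive G) ℂ) (g : G) (e : ℕ) :
    χ (Additive.ofMul (g ^ e)) = χ (Additive.ofMul g) ^ e := by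
  rw [ofMul_pow, AddChar.map_nsmul_eq_pow]

omit [Fintype G] [DecidableEq G] in
/-- `χ(1) = 1`. [folklore] -/
private theorem char_one₄ (χ : AddChar (Additive G) ℂ) : χ (Additive.ofMul (1 : G)) = 1 := by
  rw [ofMul_one, AddChar.map_zero_eq_one]

omit [Fintype G] [DecidableEq G] in
/-- `χ(g) ≠ 0`. [folklore] -/
private theorem char_ne_zero₄ (χ : AddChar (Additive G) ℂ) (g : G) : χ (Additive.ofMul g) ≠ 0 := by
  intro h0
  have := char_mul₄ χ g g⁻¹
  rw [mul_inv_cancel, char_one₄, h0, zero_mul] at this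
  exact one_ne_zero this

omit [Fintype G] [DecidableEq G] in
/-- `χ(g⁻¹) = χ(g)⁻¹`. [folklore] -/
private theorem char_inv₄ (χ : AddChar (Additive G) ℂ) (g : G) :
    χ (Additive.ofMul g⁻¹) = (χ (Additive.ofMul g))⁻¹ := by
  have := char_mul₄ χ g g⁻¹
  rw [mul_inv_cancel, char_one₄] at this
  exact (eq_inv_of_mul_eq_one_right this.symm)

omit [Fintype G] [DecidableEq G] in
/-- `χ(s) = χ(g)` iff `g⁻¹s ∈ ker χ`. [folklore] -/
private theorem char_eq_iff_inv_mul_mem₄ {H : Subgroup G} (χ : AddChar (Additive G) ℂ)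
    (hker : ∀ g : G, χ (Additive.ofMul g) = 1 ↔ g ∈ H) (g s : G) :
    χ (Additive.ofMul s) = χ (Additive.ofMul g) ↔ g⁻¹ * s ∈ H := by
  rw [← hker]
  have h1 : χ (Additive.ofMul (g⁻¹ * s)) * χ (Additive.ofMul g) = χ (Additive.ofMul s) := by
    rw [← char_mul₄, mul_comm g⁻¹ s, inv_mul_cancel_right]
  constructor
  · intro hs
    rw [hs] at h1
    exact mul_left_eq_self₀.1 h1 |>.resolve_right (char_ne_zero₄ χ g)
  · intro h
    rw [h, one_mul] at h1
    exact h1.symm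

omit [Fintype G] [DecidableEq G] in
/-- `ρ² = 1` for the conjugation of a CM type. [folklore] -/
private theorem rho_mul_rho₄ (h : IsCMTypeWith ρ (Φ : Set G)) : ρ * ρ = 1 := by
  have := h.invol (1 : G)
  simpa [smul_eq_mul] using this

omit [Fintype G] [DecidableEq G] in
/-- `ρx ∈ Φ ↔ x ∉ Φ`. [folklore] -/
private theorem rho_mul_mem_iff₄ (h : IsCMTypeWith ρ (Φ : Set G)) (x : G) : ρ * x ∈ Φ ↔ x ∉ Φ := by
  have := h.rho_smul_mem_iff x
  simpa only [smul_eq_mul, Finset.mem_coe] using this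

/-- `i ≠ 1` in `ℂ`. [folklore] -/
private theorem I_ne_one : Complex.I ≠ 1 := fun h => by simpa using congrArg Complex.re h

/-- `i ≠ −1` in `ℂ`. [folklore] -/
private theorem I_ne_neg_one : Complex.I ≠ -1 := fun h => by simpa using congrArg Complex.re h

/-- `−i ≠ 1` in `ℂ`. [folklore] -/
private theorem neg_I_ne_one : -Complex.I ≠ 1 := fun h => by simpa using congrArg Complex.re h

/-- `−i ≠ −1` in `ℂ`. [folklore] -/
private theorem neg_I_ne_neg_one : -Complex.I ≠ -1 := fun h => by simpa using congrArg Complex.re h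

/-- `−i ≠ i` in `ℂ`. [folklore] -/
private theorem neg_I_ne_I : -Complex.I ≠ Complex.I := fun h => by
  have := congrArg Complex.im h
  simp at this
  norm_num at this

/-- `−1 ≠ 1` in `ℂ`. [folklore] -/
private theorem neg_one_ne_one_complex : (-1 : ℂ) ≠ 1 := fun h => by
  have := congrArg Complex.re h
  simp at this
  norm_num at this

/-- `(a − b) + (c − d)i = 0` with natural `a, b, c, d` forces `a = b` and `c = d`. [folklore] -/
private theorem eq_and_eq_of_complex_eq_zero {a b c d : ℕ}
    (h : ((a : ℂ) - b) + ((c : ℂ) - d) * Complex.I = 0) : a = b ∧ c = d := by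
  have e1 : (((a : ℂ) - b) + ((c : ℂ) - d) * Complex.I).re = (a : ℝ) - b := by simp
  have e2 : (((a : ℂ) - b) + ((c : ℂ) - d) * Complex.I).im = (c : ℝ) - d := by simp
  have hre : (a : ℝ) - b = 0 := by rw [← e1, h, Complex.zero_re]
  have him : (c : ℝ) - d = 0 := by rw [← e2, h, Complex.zero_im]
  constructor
  · exact_mod_cast (sub_eq_zero.1 hre)
  · exact_mod_cast (sub_eq_zero.1 him)

end Helpers

/-! ## §1 Kernels of index `4`: vanishing iff the type halves every coset -/

section IndexFour

omit [Fintype G] [DecidableEq G] in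
/-- `χ(g)^{[G : ker χ]} = 1`. [folklore] -/
private theorem char_pow_index_eq_one₄ {H : Subgroup G} (χ : AddChar (Additive G) ℂ)
    (hker : ∀ g : G, χ (Additive.ofMul g) = 1 ↔ g ∈ H) (g : G) : χ (Additive.ofMul g) ^ H.index = 1 := by
  rw [← char_pow₄, hker, ← QuotientGroup.eq_one_iff, QuotientGroup.mk_pow, Subgroup.index_eq_card,
    pow_card_eq_one']

omit [Fintype G] [DecidableEq G] in
/-- A character with kernel of index `4` takes the values `1, i, −1, −i`. [folklore] -/
private theorem char_mem_of_index_four {H : Subgroup G} (χ : AddChar (Additive G) ℂ)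
    (hker : ∀ g : G, χ (Additive.ofMul g) = 1 ↔ g ∈ H) (hidx : H.index = 4) (g : G) :
    χ (Additive.ofMul g) = 1 ∨ χ (Additive.ofMul g) = Complex.I ∨ χ (Additive.ofMul g) = -1 ∨
      χ (Additive.ofMul g) = -Complex.I := by
  set z := χ (Additive.ofMul g) with hz
  have h4 : z ^ 4 = 1 := by rw [hz, ← hidx]; exact char_pow_index_eq_one₄ χ hker g
  have hfac : (z - 1) * (z + 1) * ((z - Complex.I) * (z + Complex.I)) = z ^ 4 - 1 := by
    linear_combination (-(z ^ 2 - 1)) * Complex.I_sq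
  rw [h4, sub_self] at hfac
  rcases mul_eq_zero.1 hfac with h12 | h34
  · rcases mul_eq_zero.1 h12 with h1 | h2
    · exact Or.inl (sub_eq_zero.1 h1)
    · exact Or.inr (Or.inr (Or.inl (eq_neg_of_add_eq_zero_left h2)))
  · rcases mul_eq_zero.1 h34 with h3 | h4'
    · exact Or.inr (Or.inl (sub_eq_zero.1 h3))
    · exact Or.inr (Or.inr (Or.inr (eq_neg_of_add_eq_zero_left h4')))

omit [DecidableEq G] in
/-- **A character with kernel of index `4` attains `i`** (a generator `γH` of `G/H ≅ ℤ/4` has `χ(γ)² = −1`; replace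
`γ` by `γ⁻¹` if `χ(γ) = −i`). [folklore] -/
private theorem exists_char_eq_I_of_index_four {H : Subgroup G} (χ : AddChar (Additive G) ℂ)
    (hker : ∀ g : G, χ (Additive.ofMul g) = 1 ↔ g ∈ H) (hidx : H.index = 4) :
    ∃ γ : G, χ (Additive.ofMul γ) = Complex.I := by
  haveI := isCyclic_quotient_of_ker χ hker
  obtain ⟨q, hq⟩ := IsCyclic.exists_generator (α := G ⧸ H)
  obtain ⟨σ, rfl⟩ := QuotientGroup.mk_surjective q
  have hord : orderOf (σ : G ⧸ H) = 4 := by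
    rw [orderOf_eq_card_of_forall_mem_zpowers hq, ← Subgroup.index_eq_card, hidx]
  have h2 : χ (Additive.ofMul σ) ^ 2 ≠ 1 := by
    intro h
    rw [← char_pow₄, hker, ← QuotientGroup.eq_one_iff, QuotientGroup.mk_pow] at h
    exact pow_ne_one_of_lt_orderOf two_ne_zero (by rw [hord]; norm_num) h
  rcases char_mem_of_index_four χ hker hidx σ with h1 | hI | hm1 | hmI
  · exact absurd (by rw [h1]; norm_num) h2
  · exact ⟨σ, hI⟩
  · exact absurd (by rw [hm1]; norm_num) h2
  · refine ⟨σ⁻¹, ?_⟩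
    rw [char_inv₄, hmI, inv_neg, Complex.inv_I, neg_neg]

omit [Fintype G] [DecidableEq G] in
/-- A character with kernel `H ∌ ρ` is odd: `χ(ρ) = −1` (`ρ² = 1`, `χ(ρ) ≠ 1`). [cite: Kubota1965, §4 Lemma 2] -/
private theorem char_rho_eq_neg_one₄ {H : Subgroup G} (hρH : ρ ∉ H) (hρ2 : ρ * ρ = 1) (χ : AddChar (Additive G) ℂ)
    (hker : ∀ g : G, χ (Additive.ofMul g) = 1 ↔ g ∈ H) : χ (Additive.ofMul ρ) = -1 := by
  have hsq : χ (Additive.ofMul ρ) * χ (Additive.ofMul ρ) = 1 := by rw [← char_mul₄, hρ2, char_one₄]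
  rcases mul_self_eq_one_iff.1 hsq with h | h
  · exact absurd ((hker ρ).1 h) hρH
  · exact h

/-- **The fibres of a character are cosets of its kernel, each of size `|H|`**: `#{x : χ(x) = χ(g)} = |H|`.
[folklore] -/
private theorem card_filter_univ_char_eq {H : Subgroup G} (χ : AddChar (Additive G) ℂ)
    (hker : ∀ g : G, χ (Additive.ofMul g) = 1 ↔ g ∈ H) (g : G) :
    (Finset.univ.filter fun x : G => χ (Additive.ofMul x) = χ (Additive.ofMul g)).card = Nat.card H := by
  have himg : (Finset.univ.filter fun x : G => χ (Additive.ofMul x) = χ (Additive.ofMul g)) =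
      (Finset.univ.filter fun x : G => x ∈ H).image fun x => g * x := by
    ext x
    simp only [Finset.mem_filter, Finset.mem_univ, true_and, Finset.mem_image]
    rw [char_eq_iff_inv_mul_mem₄ χ hker]
    constructor
    · intro hx
      exact ⟨g⁻¹ * x, hx, by rw [mul_inv_cancel_left]⟩
    · rintro ⟨y, hy, rfl⟩
      rwa [inv_mul_cancel_left]
  rw [himg, Finset.card_image_of_injective _ (mul_right_injective g)]
  have hHc : (H : Set G) = ↑(Finset.univ.filter fun x : G => x ∈ H) := by
    ext x; simp
  have hH : Nat.card H = (H : Set G).ncard := Nat.card_coe_set_eq (H : Set G)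
  rw [hH, hHc, Set.ncard_coe_finset]

/-- **`c_v + c_{−v} = |H|`**: for a CM type `S`, a character `χ` with kernel `H ∌ ρ`, and any `g`:
`#{s ∈ S : χ(s) = χ(g)} + #{s ∈ S : χ(s) = −χ(g)} = |H|` (`s ↦ ρs` exchanges `{s ∈ S : χ(s) = −v}` and
`{x ∉ S : χ(x) = v}`, and the whole fibre `{χ = v}` has `|H|` elements). [cite: Kubota1965, §4 Lemma 2] -/
private theorem card_filter_add_card_filter_neg_eq (h : IsCMTypeWith ρ (Φ : Set G)) {H : Subgroup G}
    (hρH : ρ ∉ H) (χ : AddChar (Additive G) ℂ) (hker : ∀ g : G, χ (Additive.ofMul g) = 1 ↔ g ∈ H) (g : G) :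
    (Φ.filter fun s => χ (Additive.ofMul s) = χ (Additive.ofMul g)).card +
      (Φ.filter fun s => χ (Additive.ofMul s) = -χ (Additive.ofMul g)).card = Nat.card H := by
  have hρ2 := rho_mul_rho₄ h
  have hχρ := char_rho_eq_neg_one₄ hρH hρ2 χ hker
  have hinj : Function.Injective fun s : G => ρ * s := fun a b hab => mul_left_cancel hab
  -- `ρ` maps `{s ∈ S : χ s = −v}` onto `{x ∉ S : χ x = v}`
  have himg : (Φᶜ.filter fun x => χ (Additive.ofMul x) = χ (Additive.ofMul g)) =
      (Φ.filter fun s => χ (Additive.ofMul s) = -χ (Additive.ofMul g)).image fun s => ρ * s := by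
    ext x
    simp only [Finset.mem_filter, Finset.mem_compl, Finset.mem_image]
    constructor
    · rintro ⟨hx, hχx⟩
      refine ⟨ρ * x, ⟨(rho_mul_mem_iff₄ h x).2 hx, ?_⟩, by rw [← mul_assoc, hρ2, one_mul]⟩
      rw [char_mul₄, hχρ, hχx, neg_one_mul]
    · rintro ⟨s, ⟨hs, hχs⟩, rfl⟩
      refine ⟨fun hx => (rho_mul_mem_iff₄ h s).1 hx hs, ?_⟩
      rw [char_mul₄, hχρ, hχs, neg_one_mul, neg_neg]
  have hc : (Φᶜ.filter fun x => χ (Additive.ofMul x) = χ (Additive.ofMul g)).card =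
      (Φ.filter fun s => χ (Additive.ofMul s) = -χ (Additive.ofMul g)).card := by
    rw [himg, Finset.card_image_of_injective _ hinj]
  have hsplit : (Φ.filter fun s => χ (Additive.ofMul s) = χ (Additive.ofMul g)).card +
      (Φᶜ.filter fun x => χ (Additive.ofMul x) = χ (Additive.ofMul g)).card =
      (Finset.univ.filter fun x : G => χ (Additive.ofMul x) = χ (Additive.ofMul g)).card := by
    rw [← Finset.card_union_of_disjoint (Finset.disjoint_filter_filter disjoint_compl_right),
      ← Finset.filter_union, Finset.union_compl]
  rw [← hc, hsplit, card_filter_univ_char_eq χ hker g]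

omit [Fintype G] [DecidableEq G] in
/-- **The character sum of an index-`4` character, by fibres**: with `χ(γ) = i`,
`Σ_{s∈S} χ(s) = (c₁ − c₋₁) + (c_i − c₋ᵢ)·i`, `c_v = #{s ∈ S : χ(s) = v}`. [cite: Kubota1965, §4 Lemma 2] -/
private theorem sum_char_eq_of_index_four {H : Subgroup G} (χ : AddChar (Additive G) ℂ)
    (hker : ∀ g : G, χ (Additive.ofMul g) = 1 ↔ g ∈ H) (hidx : H.index = 4) [Finite G] (S : Finset G) :
    ∑ s ∈ S, χ (Additive.ofMul s) =
      ((S.filter fun s => χ (Additive.ofMul s) = 1).card : ℂ) -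
        ((S.filter fun s => χ (Additive.ofMul s) = -1).card : ℂ) +
      (((S.filter fun s => χ (Additive.ofMul s) = Complex.I).card : ℂ) -
        ((S.filter fun s => χ (Additive.ofMul s) = -Complex.I).card : ℂ)) * Complex.I := by
  haveI : Fintype G := Fintype.ofFinite G
  -- pointwise decomposition over the four values
  have hpt : ∀ s : G, χ (Additive.ofMul s) =
      (if χ (Additive.ofMul s) = 1 then (1 : ℂ) else 0) - (if χ (Additive.ofMul s) = -1 then (1 : ℂ) else 0) +
      ((if χ (Additive.ofMul s) = Complex.I then (1 : ℂ) else 0) -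
        (if χ (Additive.ofMul s) = -Complex.I then (1 : ℂ) else 0)) * Complex.I := by
    intro s
    rcases char_mem_of_index_four χ hker hidx s with h | h | h | h <;> rw [h]
    · rw [if_pos rfl, if_neg neg_one_ne_one_complex.symm, if_neg I_ne_one.symm, if_neg neg_I_ne_one.symm]; ring
    · rw [if_neg I_ne_one, if_neg I_ne_neg_one, if_pos rfl, if_neg neg_I_ne_I.symm]; ring
    · rw [if_neg neg_one_ne_one_complex, if_pos rfl, if_neg I_ne_neg_one.symm, if_neg neg_I_ne_neg_one.symm]
      ring
    · rw [if_neg neg_I_ne_one, if_neg neg_I_ne_neg_one, if_neg neg_I_ne_I, if_pos rfl]; ring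
  rw [Finset.sum_congr rfl fun s _ => hpt s, Finset.sum_add_distrib, Finset.sum_sub_distrib, ← Finset.sum_mul,
    Finset.sum_sub_distrib, Finset.sum_boole, Finset.sum_boole, Finset.sum_boole, Finset.sum_boole]

/-- **KERNELS OF INDEX `4`: THE CHARACTERS VANISH IFF THE TYPE HALVES EVERY COSET.**  For a CM type `S`
(`S ⊔ ρS = G`) of a finite abelian group, a subgroup `H ∌ ρ` of index `4` and a character `χ` with `ker χ = H`
(so `G/H ≅ ℤ/4` and `χ(ρ) = −1`): `Σ_{s∈S} χ(s) = 0 ⟺ 2·#(S ∩ gH) = |H|` for every `g ∈ G`.  On the CM field: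
the characters belonging to a CYCLIC QUARTIC CM subfield `F` vanish on the type iff every embedding of `F` has
exactly `[K:F]/2` extensions in the type (Yanai's `a = b`). [cite: Kubota1965, §4 Lemma 2]
[cite: Gordon1999HodgeAVSurvey, 9.4.3 (Theorem [B.140])] -/
theorem sum_char_eq_zero_iff_of_index_four (h : IsCMTypeWith ρ (Φ : Set G)) {H : Subgroup G} (hρH : ρ ∉ H)
    (χ : AddChar (Additive G) ℂ) (hker : ∀ g : G, χ (Additive.ofMul g) = 1 ↔ g ∈ H) (hidx : H.index = 4) :
    ∑ s ∈ Φ, χ (Additive.ofMul s) = 0 ↔ ∀ g : G, 2 * (Φ.filter fun s => g⁻¹ * s ∈ H).card = Nat.card H := by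
  obtain ⟨γ, hγ⟩ := exists_char_eq_I_of_index_four χ hker hidx
  -- the coset counts are the fibre counts
  have hcos : ∀ g : G, (Φ.filter fun s => g⁻¹ * s ∈ H) =
      Φ.filter fun s => χ (Additive.ofMul s) = χ (Additive.ofMul g) := fun g =>
    Finset.filter_congr fun s _ => (char_eq_iff_inv_mul_mem₄ χ hker g s).symm
  -- the pair relations `c₁ + c₋₁ = |H|`, `c_i + c₋ᵢ = |H|`
  have hp1 := card_filter_add_card_filter_neg_eq h hρH χ hker (1 : G)
  rw [char_one₄] at hp1
  have hpI := card_filter_add_card_filter_neg_eq h hρH χ hker γ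
  rw [hγ] at hpI
  have hsum := sum_char_eq_of_index_four χ hker hidx Φ
  constructor
  · intro h0 g
    rw [h0] at hsum
    obtain ⟨e1, eI⟩ := eq_and_eq_of_complex_eq_zero hsum.symm
    rw [hcos g]
    rcases char_mem_of_index_four χ hker hidx g with hg | hg | hg | hg <;> rw [hg] <;> omega
  · intro hall
    have h1 := hall 1
    rw [hcos 1, char_one₄] at h1
    have hI := hall γ
    rw [hcos γ, hγ] at hI
    have e1 : (Φ.filter fun s => χ (Additive.ofMul s) = 1).card =
        (Φ.filter fun s => χ (Additive.ofMul s) = -1).card := by omega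
    have eI : (Φ.filter fun s => χ (Additive.ofMul s) = Complex.I).card =
        (Φ.filter fun s => χ (Additive.ofMul s) = -Complex.I).card := by omega
    rw [hsum, e1, eI, sub_self, sub_self, zero_mul, add_zero]

omit [DecidableEq G] in
/-- **All characters of an index-`4` kernel at once**: for `H ∌ ρ` of index `4` with `G/H` cyclic, the characters
with kernel `H` vanish on `S` iff `S` halves every coset of `H`. [cite: Kubota1965, §4 Lemma 2]
[cite: Gordon1999HodgeAVSurvey, 9.4.3 (Theorem [B.140])] [cite: White1993SporadicCycles, §4, proof of Lemma 3 (p. 131)] -/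
theorem forall_sum_char_eq_zero_iff_of_index_four (h : IsCMTypeWith ρ (Φ : Set G)) {H : Subgroup G}
    (hρH : ρ ∉ H) (hidx : H.index = 4) (hcyc : IsCyclic (G ⧸ H)) :
    (∀ χ : AddChar (Additive G) ℂ, (∀ g : G, χ (Additive.ofMul g) = 1 ↔ g ∈ H) →
        ∑ s ∈ Φ, χ (Additive.ofMul s) = 0) ↔
      ∀ g : G, 2 * (Φ.filter fun s => g⁻¹ * s ∈ H).card = Nat.card H := by
  rw [forall_sum_char_eq_zero_iff_exists hρH (rho_mul_rho₄ h) hcyc Φ]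
  constructor
  · rintro ⟨χ, hker, h0⟩
    exact (sum_char_eq_zero_iff_of_index_four h hρH χ hker hidx).1 h0
  · intro hall
    obtain ⟨χ, -, hker⟩ := exists_oddChar_ker hρH (rho_mul_rho₄ h) hcyc
    exact ⟨χ, hker, (sum_char_eq_zero_iff_of_index_four h hρH χ hker hidx).2 hall⟩

end IndexFour

/-! ## §2 `rank + #B₂ + 2·#B₄ ≤ |G|/2 + 1`, with equality in exponent `4` -/

section Rank

/-- **THE WEIL QUADRATIC AND CYCLIC QUARTIC KERNELS COUNT AT MOST THE DEFECT**: for every CM type of every finite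
abelian group, `rank(S) + #{H ∌ ρ : [G:H] = 2, #(S ∩ H) = #(S ∖ H)} + 2·#{H ∌ ρ : [G:H] = 4, G/H cyclic, S halves
every coset of H} ≤ |G|/2 + 1` (`φ(2) = 1`, `φ(4) = 2` characters per kernel in Kubota's `Σ_H φ([G:H])`).
[cite: Kubota1965, §4 Lemma 2] -/
theorem typeRank_add_card_add_two_mul_card_le (h : IsCMTypeWith ρ (Φ : Set G)) :
    typeRank G (Φ : Set G) +
        ((Finset.univ : Finset (Subgroup G)).filter fun H => ρ ∉ H ∧ H.index = 2 ∧
          (Φ.filter fun s => s ∈ H).card = (Φ.filter fun s => s ∉ H).card).card +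
        2 * ((Finset.univ : Finset (Subgroup G)).filter fun H : Subgroup G => ρ ∉ H ∧ H.index = 4 ∧
          IsCyclic (G ⧸ H) ∧ ∀ g : G, 2 * (Φ.filter fun s => g⁻¹ * s ∈ H).card = Nat.card H).card ≤
      Fintype.card G / 2 + 1 := by
  have hρ2 := rho_mul_rho₄ h
  have key := typeRank_add_sum_totient_eq h
  set A := (Finset.univ : Finset (Subgroup G)).filter (fun H => ρ ∉ H ∧ IsCyclic (G ⧸ H) ∧
    ∀ χ : AddChar (Additive G) ℂ, (∀ g : G, χ (Additive.ofMul g) = 1 ↔ g ∈ H) →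
      ∑ s ∈ Φ, χ (Additive.ofMul s) = 0) with hA
  set B₂ := (Finset.univ : Finset (Subgroup G)).filter (fun H => ρ ∉ H ∧ H.index = 2 ∧
    (Φ.filter fun s => s ∈ H).card = (Φ.filter fun s => s ∉ H).card) with hB₂
  set B₄ := (Finset.univ : Finset (Subgroup G)).filter (fun H : Subgroup G => ρ ∉ H ∧ H.index = 4 ∧
    IsCyclic (G ⧸ H) ∧ ∀ g : G, 2 * (Φ.filter fun s => g⁻¹ * s ∈ H).card = Nat.card H) with hB₄
  haveI : Fact (Nat.Prime 2) := ⟨Nat.prime_two⟩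
  have hsub₂ : B₂ ⊆ A := by
    intro H hH
    rw [hB₂, Finset.mem_filter] at hH
    obtain ⟨-, hρH, hidx, hsplit⟩ := hH
    rw [hA, Finset.mem_filter]
    exact ⟨Finset.mem_univ _, hρH, isCyclic_of_prime_card (p := 2) (by rw [← Subgroup.index_eq_card, hidx]),
      (forall_sum_char_eq_zero_iff_of_index_two hρ2 hρH hidx Φ).2 hsplit⟩
  have hsub₄ : B₄ ⊆ A := by
    intro H hH
    rw [hB₄, Finset.mem_filter] at hH
    obtain ⟨-, hρH, hidx, hcyc, hhalf⟩ := hH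
    rw [hA, Finset.mem_filter]
    exact ⟨Finset.mem_univ _, hρH, hcyc, (forall_sum_char_eq_zero_iff_of_index_four h hρH hidx hcyc).2 hhalf⟩
  have hdisj : Disjoint B₂ B₄ := by
    rw [Finset.disjoint_left]
    intro H h2 h4
    rw [hB₂, Finset.mem_filter] at h2
    rw [hB₄, Finset.mem_filter] at h4
    have := h2.2.2.1
    rw [h4.2.2.1] at this
    norm_num at this
  have hsum₂ : ∑ H ∈ B₂, H.index.totient = B₂.card := by
    rw [Finset.card_eq_sum_ones]
    exact Finset.sum_congr rfl fun H hH => by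
      rw [hB₂, Finset.mem_filter] at hH
      rw [hH.2.2.1, Nat.totient_two]
  have hsum₄ : ∑ H ∈ B₄, H.index.totient = 2 * B₄.card := by
    rw [Finset.card_eq_sum_ones, Finset.mul_sum]
    exact Finset.sum_congr rfl fun H hH => by
      rw [hB₄, Finset.mem_filter] at hH
      rw [hH.2.2.1]
      decide
  have hle : ∑ H ∈ B₂ ∪ B₄, H.index.totient ≤ ∑ H ∈ A, H.index.totient :=
    Finset.sum_le_sum_of_subset_of_nonneg (Finset.union_subset hsub₂ hsub₄) fun _ _ _ => Nat.zero_le _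
  rw [Finset.sum_union hdisj, hsum₂, hsum₄] at hle
  omega

omit [Fintype G] [DecidableEq G] in
/-- In a group of exponent `4`, a subgroup `H ∌ ρ` with cyclic quotient has index `2` or `4` (`G/H` is cyclic of
exponent dividing `4` and non-trivial): Kubota's admissible kernels of a group of exponent `4`.
[cite: Kubota1965, §4 Lemma 2] -/
theorem index_eq_two_or_four_of_isCyclic_quotient [Finite G] (hexp : ∀ g : G, g ^ 4 = 1) {H : Subgroup G}
    (hρH : ρ ∉ H) (hcyc : IsCyclic (G ⧸ H)) : H.index = 2 ∨ H.index = 4 := by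
  haveI := hcyc
  have hdvd : H.index ∣ 4 := by
    rw [Subgroup.index_eq_card, ← IsCyclic.exponent_eq_card]
    exact Monoid.exponent_dvd_of_forall_pow_eq_one fun q => QuotientGroup.induction_on q fun g => by
      rw [← QuotientGroup.mk_pow, hexp, QuotientGroup.mk_one]
  have hne1 : H.index ≠ 1 := fun h1 => hρH (by rw [Subgroup.index_eq_one.1 h1]; exact Subgroup.mem_top ρ)
  obtain ⟨k, hk, hk'⟩ := (Nat.dvd_prime_pow Nat.prime_two).1 (show H.index ∣ 2 ^ 2 by simpa using hdvd)
  interval_cases k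
  · exact absurd (by rw [hk', pow_zero]) hne1
  · exact Or.inl (by rw [hk', pow_one])
  · exact Or.inr (by rw [hk']; norm_num)

/-- **EXPONENT `4`: THE DEFECT IS `#B₂ + 2·#B₄` EXACTLY** — on a finite abelian group with `g⁴ = 1` for all `g`,
every admissible kernel has index `2` or `4`, so for every CM type
`rank(S) + #{H ∌ ρ : [G:H] = 2, #(S ∩ H) = #(S ∖ H)} + 2·#{H ∌ ρ : [G:H] = 4, G/H cyclic, S halves every coset
of H} = |G|/2 + 1`. [cite: Kubota1965, §4 Lemma 2] [cite: Gordon1999HodgeAVSurvey, 9.4.3 (Theorem [B.140])] -/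
theorem typeRank_add_card_add_two_mul_card_eq (h : IsCMTypeWith ρ (Φ : Set G)) (hexp : ∀ g : G, g ^ 4 = 1) :
    typeRank G (Φ : Set G) +
        ((Finset.univ : Finset (Subgroup G)).filter fun H => ρ ∉ H ∧ H.index = 2 ∧
          (Φ.filter fun s => s ∈ H).card = (Φ.filter fun s => s ∉ H).card).card +
        2 * ((Finset.univ : Finset (Subgroup G)).filter fun H : Subgroup G => ρ ∉ H ∧ H.index = 4 ∧
          IsCyclic (G ⧸ H) ∧ ∀ g : G, 2 * (Φ.filter fun s => g⁻¹ * s ∈ H).card = Nat.card H).card =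
      Fintype.card G / 2 + 1 := by
  have hρ2 := rho_mul_rho₄ h
  have key := typeRank_add_sum_totient_eq h
  set A := (Finset.univ : Finset (Subgroup G)).filter (fun H => ρ ∉ H ∧ IsCyclic (G ⧸ H) ∧
    ∀ χ : AddChar (Additive G) ℂ, (∀ g : G, χ (Additive.ofMul g) = 1 ↔ g ∈ H) →
      ∑ s ∈ Φ, χ (Additive.ofMul s) = 0) with hA
  set B₂ := (Finset.univ : Finset (Subgroup G)).filter (fun H => ρ ∉ H ∧ H.index = 2 ∧
    (Φ.filter fun s => s ∈ H).card = (Φ.filter fun s => s ∉ H).card) with hB₂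
  set B₄ := (Finset.univ : Finset (Subgroup G)).filter (fun H : Subgroup G => ρ ∉ H ∧ H.index = 4 ∧
    IsCyclic (G ⧸ H) ∧ ∀ g : G, 2 * (Φ.filter fun s => g⁻¹ * s ∈ H).card = Nat.card H) with hB₄
  haveI : Fact (Nat.Prime 2) := ⟨Nat.prime_two⟩
  have hAeq : A = B₂ ∪ B₄ := by
    ext H
    rw [Finset.mem_union, hA, hB₂, hB₄, Finset.mem_filter, Finset.mem_filter, Finset.mem_filter]
    simp only [Finset.mem_univ, true_and]
    constructor
    · rintro ⟨hρH, hcyc, hall⟩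
      rcases index_eq_two_or_four_of_isCyclic_quotient hexp hρH hcyc with h2 | h4
      · exact Or.inl ⟨hρH, h2, (forall_sum_char_eq_zero_iff_of_index_two hρ2 hρH h2 Φ).1 hall⟩
      · exact Or.inr ⟨hρH, h4, hcyc, (forall_sum_char_eq_zero_iff_of_index_four h hρH h4 hcyc).1 hall⟩
    · rintro (⟨hρH, h2, hsplit⟩ | ⟨hρH, h4, hcyc, hhalf⟩)
      · exact ⟨hρH, isCyclic_of_prime_card (p := 2) (by rw [← Subgroup.index_eq_card, h2]),
          (forall_sum_char_eq_zero_iff_of_index_two hρ2 hρH h2 Φ).2 hsplit⟩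
      · exact ⟨hρH, hcyc, (forall_sum_char_eq_zero_iff_of_index_four h hρH h4 hcyc).2 hhalf⟩
  have hdisj : Disjoint B₂ B₄ := by
    rw [Finset.disjoint_left]
    intro H h2 h4
    rw [hB₂, Finset.mem_filter] at h2
    rw [hB₄, Finset.mem_filter] at h4
    have := h2.2.2.1
    rw [h4.2.2.1] at this
    norm_num at this
  have hsum₂ : ∑ H ∈ B₂, H.index.totient = B₂.card := by
    rw [Finset.card_eq_sum_ones]
    exact Finset.sum_congr rfl fun H hH => by
      rw [hB₂, Finset.mem_filter] at hH
      rw [hH.2.2.1, Nat.totient_two]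
  have hsum₄ : ∑ H ∈ B₄, H.index.totient = 2 * B₄.card := by
    rw [Finset.card_eq_sum_ones, Finset.mul_sum]
    exact Finset.sum_congr rfl fun H hH => by
      rw [hB₄, Finset.mem_filter] at hH
      rw [hH.2.2.1]
      decide
  rw [hAeq, Finset.sum_union hdisj, hsum₂, hsum₄] at key
  omega

/-- **Nondegeneracy in exponent `4`**: a CM type of a finite abelian group of exponent `4` is nondegenerate iff NO
index-`2` subgroup `H ∌ ρ` splits it evenly and NO index-`4` subgroup `H ∌ ρ` with cyclic quotient is halved by it
on every coset. [cite: Kubota1965, §4 Lemma 2] [cite: Gordon1999HodgeAVSurvey, 9.4.3 (Theorem [B.140])] -/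
theorem typeRank_eq_iff_of_exponent_four (h : IsCMTypeWith ρ (Φ : Set G)) (hexp : ∀ g : G, g ^ 4 = 1) :
    typeRank G (Φ : Set G) = Fintype.card G / 2 + 1 ↔
      (∀ H : Subgroup G, ρ ∉ H → H.index = 2 →
          (Φ.filter fun s => s ∈ H).card ≠ (Φ.filter fun s => s ∉ H).card) ∧
        ∀ H : Subgroup G, ρ ∉ H → H.index = 4 → IsCyclic (G ⧸ H) →
          ∃ g : G, 2 * (Φ.filter fun s => g⁻¹ * s ∈ H).card ≠ Nat.card H := by
  have key := typeRank_add_card_add_two_mul_card_eq h hexp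
  set B₂ := (Finset.univ : Finset (Subgroup G)).filter (fun H => ρ ∉ H ∧ H.index = 2 ∧
    (Φ.filter fun s => s ∈ H).card = (Φ.filter fun s => s ∉ H).card) with hB₂
  set B₄ := (Finset.univ : Finset (Subgroup G)).filter (fun H : Subgroup G => ρ ∉ H ∧ H.index = 4 ∧
    IsCyclic (G ⧸ H) ∧ ∀ g : G, 2 * (Φ.filter fun s => g⁻¹ * s ∈ H).card = Nat.card H) with hB₄
  rw [show typeRank G (Φ : Set G) = Fintype.card G / 2 + 1 ↔ B₂.card = 0 ∧ B₄.card = 0 by omega,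
    Finset.card_eq_zero, Finset.card_eq_zero, Finset.eq_empty_iff_forall_notMem, Finset.eq_empty_iff_forall_notMem]
  simp only [hB₂, hB₄, Finset.mem_filter, Finset.mem_univ, true_and, not_and, not_forall, ne_eq]

end Rank

end AbelianKernels

end CyclicCMType

end Literature.NumberTheory.ComplexMultiplication
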